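import Summits.CriticalPhenomena.Ising3DConformalLimit.Theorems.IsingEuclidUpgradeR2RotInvPowerLaw.Negative.GaugeBookkeeping
import HarnessLib

/-!
# Crux `IsingEuclidUpgradeR2RotInvPowerLaw` (stmt-CriticalPhenomena-0634) — negative-side support, III: the quartic anisotropy (W3)

Standing crux disprover (cdisprove cycle 1, 2026-08-17), THEOREM-ONLY file; finding F4 of
`Cruxes/IsingEuclidUpgradeR2RotInvPowerLaw/Disproof.lean`, split off for landing.

**Witness W3** (through the defining hypothesis `hG`, no definitions): the QUARTIC kernel
`G x = (Σ xᵢ⁴)/(Σ xᵢ²)³` (with `max(·,1)` guards so that `G 0 = 1`; off the origin of `ℤ³` the maxima are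
identities) — the HRP2 disprover's witness `hrp2Rigidity_false_without_RP`, transported to this crux. It is positive,
hyperoctahedrally symmetric, EXACTLY homogeneous of degree `-2` along every lattice ray — so the dyadic tower law T1
(`Δ = 1`) and the ray dilation law Sray (`Δ = 1`, every ray, every `k`) hold with constant sequences —, inside the
envelope (`‖x‖⁻²/9 ≤ G ≤ ‖x‖⁻¹`); its angular profile `Σ uᵢ⁴` is not constant: ratio isotropy S3 fails
(diagonal-to-axis ratio `→ 1/3`) and the crux shape fails.

* `q_ratioIsotropy_not_of_tower_rayDilation_envelope` — {positivity, symmetry, envelope, T1, Sray} ⊬ S3: the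
  MODEL-BLIND forms of `stub_rayRigidityTransfer` (landed for `criticalTwoPoint 3`, p165602) and
  `stub_rigidityTransfer` are false; their proofs must — and the landed one does, via `pairLimit_of_rayRV` →
  `HRP2Rigidity_of` — use nine-mirror reflection positivity of the Ising two-point function.
* `q_crux_not_of_tower_rayDilation_envelope` — {positivity, symmetry, envelope, T1, Sray} ⊬ crux shape.
-/

noncomputable section

namespace Summit.CriticalPhenomena.Ising3DConformalLimit.Theorems.IsingEuclidUpgradeR2RotInvPowerLaw.Negative

open Filter Topology Literature.Probability.LatticeModels
open Summit.CriticalPhenomena.Ising3DConformalLimit.Theorems.GapForcesFarMerging.Negative (one_le_norm_of_ne_zero)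

/-! ## The quartic kernel (hypothesis `hG`) -/

/-- Off the origin of `ℤ³`, `1 ≤ Σ xᵢ²`. -/
theorem one_le_sum_sq_of_ne_zero {x : Site 3} (hx : x ≠ 0) : (1 : ℝ) ≤ ∑ i, ((x i : ℝ)) ^ 2 :=
  le_trans (by nlinarith [one_le_norm_of_ne_zero hx]) (norm_sq_le_sum_sq x)

/-- Off the origin of `ℤ³`, `1 ≤ Σ xᵢ⁴`. -/
theorem one_le_sum_fourth_of_ne_zero {x : Site 3} (hx : x ≠ 0) : (1 : ℝ) ≤ ∑ i, ((x i : ℝ)) ^ 4 := by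
  obtain ⟨i, hi⟩ : ∃ i, x i ≠ 0 := by
    by_contra h
    push Not at h
    exact hx (funext h)
  have h1 : (1 : ℝ) ≤ ((x i : ℝ)) ^ 4 := by
    have : (1 : ℤ) ≤ (x i) ^ 4 := by
      have h2 : (1 : ℤ) ≤ (x i) ^ 2 := by nlinarith [Int.one_le_abs hi, sq_abs (x i)]
      nlinarith
    exact_mod_cast this
  exact le_trans h1 (Finset.single_le_sum (f := fun j => ((x j : ℝ)) ^ 4) (fun j _ => by positivity)
    (Finset.mem_univ i))

/-- W3 off the origin: the guards are identities. -/
theorem q_of_ne_zero {G : Site 3 → ℝ} (hG : ∀ x : Site 3, G x = max (∑ i, ((x i : ℝ)) ^ 4) 1 / (max (∑ i, ((x i : ℝ)) ^ 2) 1) ^ 3) {x : Site 3} (hx : x ≠ 0) :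
    G x = (∑ i, ((x i : ℝ)) ^ 4) / (∑ i, ((x i : ℝ)) ^ 2) ^ 3 := by
  rw [hG, max_eq_left (one_le_sum_sq_of_ne_zero hx), max_eq_left (one_le_sum_fourth_of_ne_zero hx)]

/-- W3 is positive. -/
theorem q_pos {G : Site 3 → ℝ} (hG : ∀ x : Site 3, G x = max (∑ i, ((x i : ℝ)) ^ 4) 1 / (max (∑ i, ((x i : ℝ)) ^ 2) 1) ^ 3) (x : Site 3) : 0 < G x := by
  rw [hG]; positivity

/-- W3 is hyperoctahedrally symmetric. -/
theorem q_symm {G : Site 3 → ℝ} (hG : ∀ x : Site 3, G x = max (∑ i, ((x i : ℝ)) ^ 4) 1 / (max (∑ i, ((x i : ℝ)) ^ 2) 1) ^ 3) :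
    (∀ (σ : Equiv.Perm (Fin 3)) (ε : Fin 3 → ℤ), (∀ i, ε i = 1 ∨ ε i = -1) → ∀ x, G (fun i => ε i * x (σ i)) = G x) := by
  intro σ ε hε x
  rw [hG, hG, sum_sq_symm σ ε hε x, sum_fourth_symm σ ε hε x]

/-- Exact homogeneity of degree `-2` along lattice rays: `G (m • v) = G v / m²`. -/
theorem q_zsmul {G : Site 3 → ℝ} (hG : ∀ x : Site 3, G x = max (∑ i, ((x i : ℝ)) ^ 4) 1 / (max (∑ i, ((x i : ℝ)) ^ 2) 1) ^ 3) {v : Site 3} (hv : v ≠ 0) {m : ℤ} (hm : m ≠ 0) :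
    G (m • v) = G v / (m : ℝ) ^ 2 := by
  have hmv : m • v ≠ 0 := smul_ne_zero hm hv
  rw [q_of_ne_zero hG hmv, q_of_ne_zero hG hv]
  have h4 : (∑ i, ((((m • v) i : ℤ) : ℝ)) ^ 4) = (m : ℝ) ^ 4 * ∑ i, ((v i : ℝ)) ^ 4 := by
    rw [Finset.mul_sum]
    refine Finset.sum_congr rfl fun i _ => ?_
    simp only [Pi.smul_apply, smul_eq_mul, Int.cast_mul]
    ring
  have h2 : (∑ i, ((((m • v) i : ℤ) : ℝ)) ^ 2) = (m : ℝ) ^ 2 * ∑ i, ((v i : ℝ)) ^ 2 := by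
    rw [Finset.mul_sum]
    refine Finset.sum_congr rfl fun i _ => ?_
    simp only [Pi.smul_apply, smul_eq_mul, Int.cast_mul]
    ring
  rw [h4, h2]
  have hS : (0 : ℝ) < ∑ i, ((v i : ℝ)) ^ 2 := lt_of_lt_of_le one_pos (one_le_sum_sq_of_ne_zero hv)
  have hm' : (m : ℝ) ≠ 0 := by exact_mod_cast hm
  field_simp

/-- On the axis: `G (n e₀) = 1/n²`. -/
theorem q_single {G : Site 3 → ℝ} (hG : ∀ x : Site 3, G x = max (∑ i, ((x i : ℝ)) ^ 4) 1 / (max (∑ i, ((x i : ℝ)) ^ 2) 1) ^ 3) {n : ℕ} (hn : 1 ≤ n) : G (Pi.single 0 ((n : ℕ) : ℤ)) = 1 / (n : ℝ) ^ 2 := by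
  rw [q_of_ne_zero hG (single_nat_ne_zero hn), sum_fourth_single, sum_sq_single]
  push_cast
  have : (n : ℝ) ≠ 0 := by exact_mod_cast (by omega : n ≠ 0)
  field_simp

/-- On the diagonal: `G (n,n,n) = 1/(9n²)`. -/
theorem q_diag {G : Site 3 → ℝ} (hG : ∀ x : Site 3, G x = max (∑ i, ((x i : ℝ)) ^ 4) 1 / (max (∑ i, ((x i : ℝ)) ^ 2) 1) ^ 3) {n : ℕ} (hn : 1 ≤ n) : G (fun _ : Fin 3 => ((n : ℕ) : ℤ)) = 1 / (9 * (n : ℝ) ^ 2) := by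
  rw [q_of_ne_zero hG (diag_ne_zero hn), sum_sq_diag, sum_fourth_diag]
  have : (n : ℝ) ≠ 0 := by exact_mod_cast (by omega : n ≠ 0)
  field_simp
  ring

/-- W3 lies in the envelope: `‖x‖⁻²/9 ≤ G x ≤ ‖x‖⁻¹`. -/
theorem q_envelope {G : Site 3 → ℝ} (hG : ∀ x : Site 3, G x = max (∑ i, ((x i : ℝ)) ^ 4) 1 / (max (∑ i, ((x i : ℝ)) ^ 2) 1) ^ 3) :
    (∃ c C : ℝ, 0 < c ∧ ∀ x : Site 3, x ≠ 0 → c * (‖x‖ : ℝ) ^ (-(2 : ℝ)) ≤ G x ∧ G x ≤ C * (‖x‖ : ℝ) ^ (-(1 : ℝ))) := by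
  refine ⟨1 / 9, 1, by norm_num, fun x hx => ?_⟩
  rw [q_of_ne_zero hG hx]
  set S2 := ∑ i, ((x i : ℝ)) ^ 2 with hS2
  set S4 := ∑ i, ((x i : ℝ)) ^ 4 with hS4
  have hx1 : (1 : ℝ) ≤ ‖x‖ := one_le_norm_of_ne_zero hx
  have hS2x : ‖x‖ ^ 2 ≤ S2 := norm_sq_le_sum_sq x
  have hS2x' : S2 ≤ 3 * ‖x‖ ^ 2 := sum_sq_le_three_mul_norm_sq x
  have h42 : S4 ≤ S2 ^ 2 := by
    simp only [hS4, hS2, Fin.sum_univ_three]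
    nlinarith [mul_nonneg (sq_nonneg ((x 0 : ℝ))) (sq_nonneg ((x 1 : ℝ))),
      mul_nonneg (sq_nonneg ((x 0 : ℝ))) (sq_nonneg ((x 2 : ℝ))),
      mul_nonneg (sq_nonneg ((x 1 : ℝ))) (sq_nonneg ((x 2 : ℝ)))]
  have h24 : S2 ^ 2 ≤ 3 * S4 := by
    simp only [hS4, hS2, Fin.sum_univ_three]
    nlinarith [sq_nonneg (((x 0 : ℝ)) ^ 2 - ((x 1 : ℝ)) ^ 2), sq_nonneg (((x 0 : ℝ)) ^ 2 - ((x 2 : ℝ)) ^ 2),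
      sq_nonneg (((x 1 : ℝ)) ^ 2 - ((x 2 : ℝ)) ^ 2)]
  have hS2pos : 0 < S2 := by nlinarith
  constructor
  · rw [Real.rpow_neg (by linarith), Real.rpow_two, div_eq_mul_inv S4, le_mul_inv_iff₀ (by positivity)]
    calc 1 / 9 * (‖x‖ ^ 2)⁻¹ * S2 ^ 3 ≤ 1 / 9 * (‖x‖ ^ 2)⁻¹ * (S2 ^ 2 * (3 * ‖x‖ ^ 2)) := by
          gcongr
          nlinarith
      _ = S2 ^ 2 / 3 := by field_simp; norm_num
      _ ≤ S4 := by linarith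
  · rw [Real.rpow_neg_one, div_le_iff₀ (by positivity)]
    calc S4 ≤ S2 ^ 2 := h42
      _ = S2 ^ 2 * 1 := by ring
      _ ≤ S2 ^ 2 * (‖x‖⁻¹ * S2) := by
          gcongr
          rw [le_inv_mul_iff₀ (by linarith)]
          nlinarith
      _ = 1 * ‖x‖⁻¹ * S2 ^ 3 := by ring

/-- W3 satisfies T1 EXACTLY at `Δ = 1`: `G(2^j e₀)·(2^j)² = 1`. -/
theorem q_dyadicTowerLaw {G : Site 3 → ℝ} (hG : ∀ x : Site 3, G x = max (∑ i, ((x i : ℝ)) ^ 4) 1 / (max (∑ i, ((x i : ℝ)) ^ 2) 1) ^ 3) :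
    (∃ Δ c : ℝ, 0 < c ∧ Tendsto (fun j : ℕ => G (Pi.single 0 ((2 ^ j : ℕ) : ℤ)) * ((2 ^ j : ℕ) : ℝ) ^ (2 * Δ)) atTop (𝓝 c)) := by
  refine ⟨1, 1, one_pos, ?_⟩
  refine (tendsto_const_nhds (x := (1 : ℝ))).congr fun j => ?_
  rw [q_single hG Nat.one_le_two_pow, show (2 : ℝ) * 1 = 2 by norm_num, Real.rpow_two]
  push_cast
  have : (2 : ℝ) ^ j ≠ 0 := by positivity
  field_simp

/-- W3 satisfies the ray dilation law Sray EXACTLY at `Δ = 1` (constant sequences `1` from `n = 1` on). -/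
theorem q_rayDilationLaw {G : Site 3 → ℝ} (hG : ∀ x : Site 3, G x = max (∑ i, ((x i : ℝ)) ^ 4) 1 / (max (∑ i, ((x i : ℝ)) ^ 2) 1) ^ 3) :
    (∀ v : Site 3, v ≠ 0 → ∀ k : ℕ, 1 ≤ k → Tendsto (fun n : ℕ => G (((k * n : ℕ) : ℤ) • v) * (k : ℝ) ^ (2 * (1 : ℝ)) / G (((n : ℕ) : ℤ) • v)) atTop (𝓝 1)) := by
  intro v hv k hk
  refine (tendsto_const_nhds (x := (1 : ℝ))).congr' ?_
  filter_upwards [eventually_ge_atTop 1] with n hn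
  have hkn : ((k * n : ℕ) : ℤ) ≠ 0 := by exact_mod_cast (Nat.mul_ne_zero (by omega) (by omega))
  have hn' : ((n : ℕ) : ℤ) ≠ 0 := by exact_mod_cast (by omega : n ≠ 0)
  rw [q_zsmul hG hv hkn, q_zsmul hG hv hn', show (2 : ℝ) * 1 = 2 by norm_num, Real.rpow_two]
  have hGv : G v ≠ 0 := (q_pos hG v).ne'
  have hk0 : (k : ℝ) ≠ 0 := by exact_mod_cast (by omega : k ≠ 0)
  have hn0 : (n : ℝ) ≠ 0 := by exact_mod_cast (by omega : n ≠ 0)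
  push_cast
  field_simp

/-! ## What W3 violates -/

/-- **W3 violates ratio isotropy S3**: along the diagonal the ratio tends to `1/3`. -/
theorem q_not_ratioIsotropy {G : Site 3 → ℝ} (hG : ∀ x : Site 3, G x = max (∑ i, ((x i : ℝ)) ^ 4) 1 / (max (∑ i, ((x i : ℝ)) ^ 2) 1) ^ 3) :
    ¬ Tendsto (fun x : Site 3 => G x / G (Pi.single 0 ((⌊Real.sqrt (∑ i, ((x i : ℝ)) ^ 2)⌋₊ : ℕ) : ℤ))) cofinite (𝓝 1) := by
  intro h
  have hd := tendsto_diag_of_cofinite h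
  have hlim : Tendsto (fun n : ℕ => G (fun _ : Fin 3 => ((n : ℕ) : ℤ)) /
      G (Pi.single 0 ((⌊Real.sqrt (∑ i : Fin 3, ((((fun _ : Fin 3 => ((n : ℕ) : ℤ)) : Site 3) i : ℝ)) ^ 2)⌋₊ : ℕ) : ℤ)))
      atTop (𝓝 (Real.sqrt 3 ^ 2 / 9)) := by
    have h9 := (tendsto_floor_sqrt_three_mul_div.pow 2).div_const 9
    refine h9.congr' ?_
    filter_upwards [eventually_ge_atTop 1] with n hn
    have hm : 1 ≤ ⌊Real.sqrt 3 * (n : ℝ)⌋₊ := by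
      refine Nat.le_floor ?_
      have h1 : (1 : ℝ) ≤ Real.sqrt 3 := by rw [Real.le_sqrt (by norm_num) (by norm_num)]; norm_num
      have h2 : (1 : ℝ) ≤ n := by exact_mod_cast hn
      push_cast
      nlinarith
    rw [sqrt_sum_sq_diag, q_diag hG hn, q_single hG hm]
    have hn0 : (n : ℝ) ≠ 0 := by exact_mod_cast (by omega : n ≠ 0)
    have hm0 : ((⌊Real.sqrt 3 * (n : ℝ)⌋₊ : ℕ) : ℝ) ≠ 0 := by
      exact_mod_cast (by omega : ⌊Real.sqrt 3 * (n : ℝ)⌋₊ ≠ 0)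
    field_simp
  have := tendsto_nhds_unique hd hlim
  rw [Real.sq_sqrt (by norm_num)] at this
  norm_num at this

/-- **W3 violates the crux shape**: doubling along the axis forces `Δ = 1`; axis and diagonal then give the two
different limits `1` and `1/3`. -/
theorem q_not_crux {G : Site 3 → ℝ} (hG : ∀ x : Site 3, G x = max (∑ i, ((x i : ℝ)) ^ 4) 1 / (max (∑ i, ((x i : ℝ)) ^ 2) 1) ^ 3) :
    ¬ (∃ Δ c : ℝ, 0 < c ∧ Tendsto (fun x : Site 3 => G x * Real.sqrt (∑ i, ((x i : ℝ)) ^ 2) ^ (2 * Δ)) cofinite (𝓝 c)) := by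
  rintro ⟨Δ, c, hc, hcof⟩
  have hax : Tendsto (fun n : ℕ => G (Pi.single 0 ((n : ℕ) : ℤ)) * (n : ℝ) ^ (2 * Δ)) atTop (𝓝 c) := by
    refine (tendsto_axis_of_cofinite hcof).congr fun n => ?_
    simp only [sqrt_sum_sq_single_nat]
  have hmono : StrictMono fun n : ℕ => 2 * n := fun a b hab => by dsimp only; omega
  have hd := hax.comp hmono.tendsto_atTop
  have e : ∀ n : ℕ, 1 ≤ n → G (Pi.single 0 ((2 * n : ℕ) : ℤ)) * ((2 * n : ℕ) : ℝ) ^ (2 * Δ) =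
      (2 : ℝ) ^ (2 * Δ) / 4 * (G (Pi.single 0 ((n : ℕ) : ℤ)) * (n : ℝ) ^ (2 * Δ)) := by
    intro n hn
    rw [q_single hG hn, q_single hG (by omega)]
    push_cast
    rw [Real.mul_rpow (by norm_num) (Nat.cast_nonneg n)]
    have hn0 : (n : ℝ) ≠ 0 := by exact_mod_cast (by omega : n ≠ 0)
    field_simp
    ring
  have hd' : Tendsto (fun n : ℕ => G (Pi.single 0 ((2 * n : ℕ) : ℤ)) * ((2 * n : ℕ) : ℝ) ^ (2 * Δ))
      atTop (𝓝 ((2 : ℝ) ^ (2 * Δ) / 4 * c)) :=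
    (hax.const_mul _).congr' ((eventually_ge_atTop 1).mono fun n hn => (e n hn).symm)
  have key : (2 : ℝ) ^ (2 * Δ) / 4 * c = c := tendsto_nhds_unique hd' hd
  have hΔ : 2 * Δ = 2 := by
    have h1 : (2 : ℝ) ^ (2 * Δ) / 4 = 1 := mul_right_cancel₀ hc.ne' (key.trans (one_mul c).symm)
    refine rpow_two_inj ?_
    norm_num
    linarith
  have hc1 : c = 1 := by
    refine tendsto_nhds_unique hax (tendsto_const_nhds.congr' ?_)
    filter_upwards [eventually_ge_atTop 1] with n hn
    rw [q_single hG hn, hΔ, Real.rpow_two]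
    have hn0 : (n : ℝ) ≠ 0 := by exact_mod_cast (by omega : n ≠ 0)
    field_simp
  have hdiag : Tendsto (fun n : ℕ => G (fun _ : Fin 3 => ((n : ℕ) : ℤ)) *
      Real.sqrt (∑ i : Fin 3, ((((fun _ : Fin 3 => ((n : ℕ) : ℤ)) : Site 3) i : ℝ)) ^ 2) ^ (2 * Δ))
      atTop (𝓝 c) := tendsto_diag_of_cofinite hcof
  have hc3 : c = 1 / 3 := by
    refine tendsto_nhds_unique hdiag (tendsto_const_nhds.congr' ?_)
    filter_upwards [eventually_ge_atTop 1] with n hn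
    rw [q_diag hG hn, sqrt_sum_sq_diag, hΔ, Real.rpow_two, mul_pow, Real.sq_sqrt (by norm_num)]
    have hn0 : (n : ℝ) ≠ 0 := by exact_mod_cast (by omega : n ≠ 0)
    field_simp
    ring
  rw [hc1] at hc3
  norm_num at hc3

/-! ## The separations (F4) -/

/-- **F4a — S3 is not implied by T1 ∧ Sray ∧ envelope ∧ symmetry ∧ positivity; reflection positivity is
load-bearing in R / Rray.** For functions `G : ℤ³ → ℝ`: positivity, hyperoctahedral symmetry, the envelope, the
dyadic tower law T1 and the ray dilation law Sray along EVERY lattice ray (at some common exponent) together do NOT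
imply ratio isotropy S3 (witness W3 at `Δ = 1`). [folklore: cubic harmonic anisotropy] -/
theorem q_ratioIsotropy_not_of_tower_rayDilation_envelope :
    ¬ ∀ G : Site 3 → ℝ, (∀ x, 0 < G x) →
      (∀ (σ : Equiv.Perm (Fin 3)) (ε : Fin 3 → ℤ), (∀ i, ε i = 1 ∨ ε i = -1) → ∀ x, G (fun i => ε i * x (σ i)) = G x) →
      (∃ c C : ℝ, 0 < c ∧ ∀ x : Site 3, x ≠ 0 → c * (‖x‖ : ℝ) ^ (-(2 : ℝ)) ≤ G x ∧ G x ≤ C * (‖x‖ : ℝ) ^ (-(1 : ℝ))) →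
      (∃ Δ c : ℝ, 0 < c ∧ Tendsto (fun j : ℕ => G (Pi.single 0 ((2 ^ j : ℕ) : ℤ)) * ((2 ^ j : ℕ) : ℝ) ^ (2 * Δ)) atTop (𝓝 c)) →
      (∃ Δ : ℝ, (∀ v : Site 3, v ≠ 0 → ∀ k : ℕ, 1 ≤ k → Tendsto (fun n : ℕ => G (((k * n : ℕ) : ℤ) • v) * (k : ℝ) ^ (2 * Δ) / G (((n : ℕ) : ℤ) • v)) atTop (𝓝 1))) →
      Tendsto (fun x : Site 3 => G x / G (Pi.single 0 ((⌊Real.sqrt (∑ i, ((x i : ℝ)) ^ 2)⌋₊ : ℕ) : ℤ))) cofinite (𝓝 1) := by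
  intro hall
  set G : Site 3 → ℝ := fun x => max (∑ i, ((x i : ℝ)) ^ 4) 1 / (max (∑ i, ((x i : ℝ)) ^ 2) 1) ^ 3 with hG_def
  have hG : ∀ x : Site 3, G x = max (∑ i, ((x i : ℝ)) ^ 4) 1 / (max (∑ i, ((x i : ℝ)) ^ 2) 1) ^ 3 := fun x => rfl
  exact q_not_ratioIsotropy hG (hall G (q_pos hG) (q_symm hG) (q_envelope hG) (q_dyadicTowerLaw hG)
    ⟨1, q_rayDilationLaw hG⟩)

/-- **F4b — the crux shape is not implied by T1 ∧ Sray ∧ envelope ∧ symmetry ∧ positivity** (witness W3).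
[folklore] -/
theorem q_crux_not_of_tower_rayDilation_envelope :
    ¬ ∀ G : Site 3 → ℝ, (∀ x, 0 < G x) →
      (∀ (σ : Equiv.Perm (Fin 3)) (ε : Fin 3 → ℤ), (∀ i, ε i = 1 ∨ ε i = -1) → ∀ x, G (fun i => ε i * x (σ i)) = G x) →
      (∃ c C : ℝ, 0 < c ∧ ∀ x : Site 3, x ≠ 0 → c * (‖x‖ : ℝ) ^ (-(2 : ℝ)) ≤ G x ∧ G x ≤ C * (‖x‖ : ℝ) ^ (-(1 : ℝ))) →
      (∃ Δ c : ℝ, 0 < c ∧ Tendsto (fun j : ℕ => G (Pi.single 0 ((2 ^ j : ℕ) : ℤ)) * ((2 ^ j : ℕ) : ℝ) ^ (2 * Δ)) atTop (𝓝 c)) →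
      (∃ Δ : ℝ, (∀ v : Site 3, v ≠ 0 → ∀ k : ℕ, 1 ≤ k → Tendsto (fun n : ℕ => G (((k * n : ℕ) : ℤ) • v) * (k : ℝ) ^ (2 * Δ) / G (((n : ℕ) : ℤ) • v)) atTop (𝓝 1))) →
      (∃ Δ c : ℝ, 0 < c ∧ Tendsto (fun x : Site 3 => G x * Real.sqrt (∑ i, ((x i : ℝ)) ^ 2) ^ (2 * Δ)) cofinite (𝓝 c)) := by
  intro hall
  set G : Site 3 → ℝ := fun x => max (∑ i, ((x i : ℝ)) ^ 4) 1 / (max (∑ i, ((x i : ℝ)) ^ 2) 1) ^ 3 with hG_def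
  have hG : ∀ x : Site 3, G x = max (∑ i, ((x i : ℝ)) ^ 4) 1 / (max (∑ i, ((x i : ℝ)) ^ 2) 1) ^ 3 := fun x => rfl
  exact q_not_crux hG (hall G (q_pos hG) (q_symm hG) (q_envelope hG) (q_dyadicTowerLaw hG)
    ⟨1, q_rayDilationLaw hG⟩)

end Summit.CriticalPhenomena.Ising3DConformalLimit.Theorems.IsingEuclidUpgradeR2RotInvPowerLaw.Negative

end
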